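import Literature.Geometry.Lorentzian.CauchyDevelopmentPieceDomain
import Literature.Geometry.Lorentzian.CauchyDevelopmentGlobalHyperbolicityProofs
import Literature.Geometry.Lorentzian.CausalFutureCompactSet
import Literature.Geometry.Lorentzian.CausalFutureProofs
import Literature.Geometry.Lorentzian.MinkowskiGlobalHyperbolicity
import HarnessLib

/-!
# Crux `TameCensorship` (stmt-FinalStateConjecture-10047), line `crush-the-swallowed-interior`:
# the causal core of stub B (`stub_exactKerrBookkeeping`) — the exact region
# `E = J⁺(ιX) ∖ J⁺(ιK)` and the domain of dependence of `ι(X ∖ K)`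

Def-free causal lemmas for the registered stub `stub_exactKerrBookkeeping` of the skeleton
`Cruxes/TameCensorship/Lines/crush_the_swallowed_interior.lean` (lead c1). There `𝒟` is a
(maximal vacuum) Cauchy development of a datum on `X`, `φ : N → X` an open embedding with
co-compact range, `K = (range φ)ᶜ` the perturbed core, `swallowed = J⁺(ιK)` and
`E = J⁺(ιX) ∖ swallowed` the region the stub asserts to be EXACTLY Kerr. Everything below is pure
causal theory of a Cauchy development `𝒟` (any dimension, any open embedding `φ`), in the
vocabulary of the stub:

* `causalFuture_singleton_subset_of_mem` — **clause (B2) verbatim**: `J⁺(m) ⊆ J⁺(T)` for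
  `m ∈ J⁺(T)` (transitivity `causalFuture_causalFuture_eq`);
* `mem_exactRegion_of_mem_causalFuture`, `mem_exactRegion_of_mem_chronologicalPast` — `E` is
  past-convex inside `J⁺(ιX)`: a point of `J⁺(ιX)` in the causal (chronological) past of a point
  (set) of `E` lies in `E` (the shape in which clause (B4) meets `q ∈ I⁻(γ⁺) ∩ J⁺(ιX)`);
* `curve_mem_exactRegion` — `E` is causally convex: a future causal curve between two points of
  `E` lies in `E` (the shape in which clause (B3) localises the Lorentzian distance to `E`);
* `mem_causalFuture_of_mem_causalPast_of_subset_range` — a point of `J⁺(ιX) ∩ J⁻(A)`, `A ⊆ ιX`,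
  lies in `J⁺(A)` (acausality of `ιX`, `CauchyDevelopment.false_of_isFutureCausalCurveOn_range_embed`);
* `exactRegion_disjoint_closure` — `E` misses `closure (I⁺(ιK) ∪ I⁻(ιK) ∪ ιK)` for compact `K`
  (`J⁺(ιK)` is closed in the globally hyperbolic `𝒟`,
  `IsGloballyHyperbolic.isClosed_causalFuture_of_isCompact`; `J⁺(ιX) ∖ ιX = I⁺(ιX)` is open and
  misses `I⁻(ιX) ∪ ιX`; on `ιX ∖ ιK = ι(range φ)` the slab lemma
  `IsCauchyHypersurface.disjoint_closure_of_spacelike`).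

The sequel `…TameCensorshipExactRegionDomain` places `E` inside the connected component of
`𝒟 ∖ closure (I⁺(ιK) ∪ I⁻(ιK) ∪ ιK)` containing `ι(range φ)`, in which `ι(range φ)` is a Cauchy
hypersurface (the domain of dependence of the unperturbed piece of the datum).

References: O'Neill 1983, Ch. 14, pp. 402–403 (causal relations), Lemma 14.22, Lemma 14.29,
Thm. 14.38, Lemma 14.43; Hawking–Ellis 1973, §6.5–6.6, Prop. 6.6.1, 6.6.3.
-/

noncomputable section

-- The tree namespace `Summit.FinalStateConjecture.FinalStateConjecture.…` (summit = sub-problem)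
-- repeats a component by design (D-0022), which the `dupNamespace` linter would flag on every decl.
set_option linter.dupNamespace false

open scoped Manifold ContDiff Topology
open Set Filter Function TopologicalSpace Topology
open Literature.Geometry.Lorentzian

namespace Summit.FinalStateConjecture.FinalStateConjecture.Theorems.PhotonSphereChannels.TameCensorshipCrush

universe u

variable {n : ℕ} {X : Type u} [TopologicalSpace X] [ChartedSpace (EuclideanSpace ℝ (Fin n)) X]
  [IsManifold (𝓡 n) ∞ X] [ConnectedSpace X] {D : InitialDataSet (𝓡 n) X}

/-! ## Transitivity: clause (B2) and the convexity of the exact region -/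

/-- **Clause (B2) of stub B**: the causal future of a point of `J⁺(T)` lies in `J⁺(T)` — in a
Cauchy development (a manifold without boundary) the causal relation is transitive,
`J⁺(J⁺(T)) = J⁺(T)` (O'Neill 1983, Ch. 14, p. 403). With `T = ιK` this is "`swallowed` is
future-closed". [cite: ONeillSemiRiemannian1983, Ch. 14, pp. 402–403] -/
theorem causalFuture_singleton_subset_of_mem (𝒟 : CauchyDevelopment D) (T : Set 𝒟.carrier)
    {m : 𝒟.carrier} (hm : m ∈ 𝒟.metric.causalFuture 𝒟.timeOrientation T) :
    𝒟.metric.causalFuture 𝒟.timeOrientation {m} ⊆ 𝒟.metric.causalFuture 𝒟.timeOrientation T := by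
  have hn2 : (2 : ℕ∞ω) ≤ ∞ := WithTop.coe_le_coe.mpr le_top
  calc 𝒟.metric.causalFuture 𝒟.timeOrientation {m}
      ⊆ 𝒟.metric.causalFuture 𝒟.timeOrientation (𝒟.metric.causalFuture 𝒟.timeOrientation T) :=
        LorentzianMetric.causalFuture_mono (singleton_subset_iff.2 hm)
    _ = 𝒟.metric.causalFuture 𝒟.timeOrientation T :=
        LorentzianMetric.causalFuture_causalFuture_eq hn2 T

/-- Transitivity of the causal relation between points of a Cauchy development: `q ∈ J⁺(p)` and
`r ∈ J⁺(q)` give `r ∈ J⁺(p)`. O'Neill 1983, Ch. 14, p. 402. [cite: ONeillSemiRiemannian1983, Ch. 14, p. 402] -/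
theorem mem_causalFuture_singleton_trans (𝒟 : CauchyDevelopment D) {p q r : 𝒟.carrier}
    (hq : q ∈ 𝒟.metric.causalFuture 𝒟.timeOrientation {p})
    (hr : r ∈ 𝒟.metric.causalFuture 𝒟.timeOrientation {q}) :
    r ∈ 𝒟.metric.causalFuture 𝒟.timeOrientation {p} :=
  causalFuture_singleton_subset_of_mem 𝒟 {p} hq hr

/-- **The exact region is past-convex inside `J⁺(S)`**: if `p ∈ J⁺(S) ∖ J⁺(T)`, `q ∈ J⁺(S)` and
`p ∈ J⁺(q)`, then `q ∈ J⁺(S) ∖ J⁺(T)` (were `q ∈ J⁺(T)`, so would be `p`, by (B2)).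
[cite: ONeillSemiRiemannian1983, Ch. 14, pp. 402–403] -/
theorem mem_exactRegion_of_mem_causalFuture (𝒟 : CauchyDevelopment D) (S T : Set 𝒟.carrier)
    {p q : 𝒟.carrier}
    (hp : p ∈ 𝒟.metric.causalFuture 𝒟.timeOrientation S \ 𝒟.metric.causalFuture 𝒟.timeOrientation T)
    (hq : q ∈ 𝒟.metric.causalFuture 𝒟.timeOrientation S)
    (hpq : p ∈ 𝒟.metric.causalFuture 𝒟.timeOrientation {q}) :
    q ∈ 𝒟.metric.causalFuture 𝒟.timeOrientation S \ 𝒟.metric.causalFuture 𝒟.timeOrientation T :=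
  ⟨hq, fun hqT ↦ hp.2 (causalFuture_singleton_subset_of_mem 𝒟 T hqT hpq)⟩

/-- **Chronological-past form** (the shape of clause (B4): `q ∈ I⁻(W) ∩ J⁺(S)` with `W ⊆ E`): a
point of `J⁺(S)` in the chronological past of a subset of the exact region lies in the exact
region. [cite: ONeillSemiRiemannian1983, Ch. 14, pp. 402–403] -/
theorem mem_exactRegion_of_mem_chronologicalPast (𝒟 : CauchyDevelopment D) (S T : Set 𝒟.carrier)
    {W : Set 𝒟.carrier}
    (hW : W ⊆ 𝒟.metric.causalFuture 𝒟.timeOrientation S \ 𝒟.metric.causalFuture 𝒟.timeOrientation T)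
    {q : 𝒟.carrier} (hqS : q ∈ 𝒟.metric.causalFuture 𝒟.timeOrientation S)
    (hqW : q ∈ 𝒟.metric.chronologicalPast 𝒟.timeOrientation W) :
    q ∈ 𝒟.metric.causalFuture 𝒟.timeOrientation S \ 𝒟.metric.causalFuture 𝒟.timeOrientation T := by
  -- `q ∈ I⁻(W) ⊆ J⁻(W) = ⋃_{w ∈ W} J⁻(w)`, and `q ∈ J⁻(w)` iff `w ∈ J⁺(q)`
  have hqJ : q ∈ 𝒟.metric.causalPast 𝒟.timeOrientation W :=
    LorentzianMetric.chronologicalFuture_subset_causalFuture 𝒟.metric 𝒟.timeOrientation.reverse W hqW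
  rw [LorentzianMetric.causalPast, LorentzianMetric.causalFuture_eq_biUnion] at hqJ
  simp only [mem_iUnion, exists_prop] at hqJ
  obtain ⟨w, hwW, hqw⟩ := hqJ
  have hwq : w ∈ 𝒟.metric.causalFuture 𝒟.timeOrientation {q} :=
    LorentzianMetric.mem_causalPast_singleton_iff.1 hqw
  exact mem_exactRegion_of_mem_causalFuture 𝒟 S T (hW hwW) hqS hwq

/-- A point on a future causal curve on `[a, b]` lies in the causal future of the initial point.
O'Neill 1983, Ch. 14, p. 402. [cite: ONeillSemiRiemannian1983, Ch. 14, p. 402] -/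
theorem curve_mem_causalFuture_left (𝒟 : CauchyDevelopment D) {γ : ℝ → 𝒟.carrier} {a b : ℝ}
    (hγ : 𝒟.metric.IsFutureCausalCurveOn 𝒟.timeOrientation γ (Icc a b)) {t : ℝ}
    (ht : t ∈ Icc a b) : γ t ∈ 𝒟.metric.causalFuture 𝒟.timeOrientation {γ a} := by
  rcases eq_or_lt_of_le ht.1 with h | h
  · subst h
    exact LorentzianMetric.subset_causalFuture _ _ _ (mem_singleton _)
  · exact Or.inr ⟨γ a, mem_singleton _, γ, a, t, h, hγ.mono (Icc_subset_Icc le_rfl ht.2), rfl, rfl⟩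

/-- The final point of a future causal curve on `[a, b]` lies in the causal future of every point
of the curve. O'Neill 1983, Ch. 14, p. 402. [cite: ONeillSemiRiemannian1983, Ch. 14, p. 402] -/
theorem curve_mem_causalFuture_right (𝒟 : CauchyDevelopment D) {γ : ℝ → 𝒟.carrier} {a b : ℝ}
    (hγ : 𝒟.metric.IsFutureCausalCurveOn 𝒟.timeOrientation γ (Icc a b)) {t : ℝ}
    (ht : t ∈ Icc a b) : γ b ∈ 𝒟.metric.causalFuture 𝒟.timeOrientation {γ t} := by
  rcases eq_or_lt_of_le ht.2 with h | h
  · subst h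
    exact LorentzianMetric.subset_causalFuture _ _ _ (mem_singleton _)
  · exact Or.inr ⟨γ t, mem_singleton _, γ, t, b, h, hγ.mono (Icc_subset_Icc ht.1 le_rfl), rfl, rfl⟩

/-- **The exact region is causally convex** (the localisation behind clause (B3)): a future
causal curve on `[a, b]` from a point of `E = J⁺(S) ∖ J⁺(T)` to a point of `E` lies in `E` —
its points are in `J⁺(γ a) ⊆ J⁺(S)` and in the causal past of `γ b ∈ E`.
[cite: ONeillSemiRiemannian1983, Ch. 14, pp. 402–403] -/
theorem curve_mem_exactRegion (𝒟 : CauchyDevelopment D) (S T : Set 𝒟.carrier)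
    {γ : ℝ → 𝒟.carrier} {a b : ℝ}
    (hγ : 𝒟.metric.IsFutureCausalCurveOn 𝒟.timeOrientation γ (Icc a b))
    (ha : γ a ∈ 𝒟.metric.causalFuture 𝒟.timeOrientation S \ 𝒟.metric.causalFuture 𝒟.timeOrientation T)
    (hb : γ b ∈ 𝒟.metric.causalFuture 𝒟.timeOrientation S \ 𝒟.metric.causalFuture 𝒟.timeOrientation T)
    {t : ℝ} (ht : t ∈ Icc a b) :
    γ t ∈ 𝒟.metric.causalFuture 𝒟.timeOrientation S \ 𝒟.metric.causalFuture 𝒟.timeOrientation T :=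
  mem_exactRegion_of_mem_causalFuture 𝒟 S T hb
    (causalFuture_singleton_subset_of_mem 𝒟 S ha.1 (curve_mem_causalFuture_left 𝒟 hγ ht))
    (curve_mem_causalFuture_right 𝒟 hγ ht)

/-! ## Acausality of `ιX`: the exact region misses `J⁻(ιK)` -/

/-- **A point of `J⁺(ιX)` in the causal past of `A ⊆ ιX` lies in `J⁺(A)`**: if `s ≤ p ≤ a` with
`s ∈ ιX`, `a ∈ A`, then `s ≤ a` are two points of the acausal hypersurface `ιX` on one causal
curve, so `s = a` (`CauchyDevelopment.false_of_isFutureCausalCurveOn_range_embed`) and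
`p ∈ J⁺(a)`. O'Neill 1983, Ch. 14, Lemma 14.42 ff. [cite: ONeillSemiRiemannian1983, Ch. 14, Lemma 14.42 (p. 425)] -/
theorem mem_causalFuture_of_mem_causalPast_of_subset_range (𝒟 : CauchyDevelopment D)
    {A : Set 𝒟.carrier} (hA : A ⊆ range 𝒟.embed) {p : 𝒟.carrier}
    (hpS : p ∈ 𝒟.metric.causalFuture 𝒟.timeOrientation (range 𝒟.embed))
    (hpA : p ∈ 𝒟.metric.causalPast 𝒟.timeOrientation A) :
    p ∈ 𝒟.metric.causalFuture 𝒟.timeOrientation A := by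
  -- `a ∈ A` with `a ∈ J⁺(p)`
  rw [LorentzianMetric.causalPast, LorentzianMetric.causalFuture_eq_biUnion] at hpA
  simp only [mem_iUnion, exists_prop] at hpA
  obtain ⟨a, haA, hpa⟩ := hpA
  have hap : a ∈ 𝒟.metric.causalFuture 𝒟.timeOrientation {p} :=
    LorentzianMetric.mem_causalPast_singleton_iff.1 hpa
  -- `s ∈ ιX` with `p ∈ J⁺(s)`
  rw [LorentzianMetric.causalFuture_eq_biUnion] at hpS
  simp only [mem_iUnion, exists_prop] at hpS
  obtain ⟨s, hsS, hps⟩ := hpS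
  have has : a ∈ 𝒟.metric.causalFuture 𝒟.timeOrientation {s} :=
    mem_causalFuture_singleton_trans 𝒟 hps hap
  rcases has with has | ⟨s', hs', γ, c, d, hcd, hγ, hγc, hγd⟩
  · -- `a = s`: then `p ∈ J⁺(s) = J⁺(a) ⊆ J⁺(A)`
    rw [mem_singleton_iff] at has
    subst has
    exact LorentzianMetric.causalFuture_mono (singleton_subset_iff.2 haA) hps
  · -- a genuine causal curve from `s ∈ ιX` to `a ∈ ιX`: impossible
    rw [mem_singleton_iff] at hs'
    subst hs'
    exact (𝒟.false_of_isFutureCausalCurveOn_range_embed hcd hγ (hγc ▸ hsS) (hγd ▸ hA haA)).elim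

/-! ## The exact region misses `closure (I⁺(ιK) ∪ I⁻(ιK) ∪ ιK)` -/

/-- `J⁺(A)` is closed for compact `A` in a Cauchy development (global hyperbolicity,
O'Neill 1983, Ch. 14, Lemma 14.22 with Cor. 14.39). [cite: ONeillSemiRiemannian1983, Ch. 14, Lemma 14.22 (p. 412)] -/
theorem isClosed_causalFuture_of_isCompact (𝒟 : CauchyDevelopment D) {A : Set 𝒟.carrier}
    (hA : IsCompact A) : IsClosed (𝒟.metric.causalFuture 𝒟.timeOrientation A) := by
  have hn2 : (2 : ℕ∞ω) ≤ ∞ := WithTop.coe_le_coe.mpr le_top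
  exact 𝒟.isGloballyHyperbolic.isClosed_causalFuture_of_isCompact hn2 hA

/-- **The exact region misses the closure of `I⁺(A) ∪ I⁻(A) ∪ A`** for a compact `A = ιK ⊆ ιX`
whose complement in `ιX` is `ι(O)`, `O` open: a point `p ∈ J⁺(ιX) ∖ J⁺(A)` is either on `ιX`,
hence on the relatively open spacelike piece `ι(O)`, which misses that closure by the slab lemma
`IsCauchyHypersurface.disjoint_closure_of_spacelike`; or in the open set `I⁺(ιX) = J⁺(ιX) ∖ ιX`,
which misses `I⁻(A) ∪ A ⊆ I⁻(ιX) ∪ ιX`, so that `p ∈ closure I⁺(A) ⊆ J⁺(A)` (closed) — excluded.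
Hawking–Ellis 1973, §6.5–6.6; O'Neill 1983, Ch. 14, Lemma 14.29, Lemma 14.43.
[cite: ONeillSemiRiemannian1983, Ch. 14, Lemma 14.29 and Lemma 14.43 (pp. 415, 426)] -/
theorem exactRegion_disjoint_closure (𝒟 : CauchyDevelopment D) {O : Set X} (hO : IsOpen O)
    (hK : IsCompact Oᶜ) :
    Disjoint (𝒟.metric.causalFuture 𝒟.timeOrientation (range 𝒟.embed) \
        𝒟.metric.causalFuture 𝒟.timeOrientation (𝒟.embed '' Oᶜ))
      (closure (𝒟.metric.chronologicalFuture 𝒟.timeOrientation (range 𝒟.embed \ 𝒟.embed '' O) ∪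
        𝒟.metric.chronologicalPast 𝒟.timeOrientation (range 𝒟.embed \ 𝒟.embed '' O) ∪
        (range 𝒟.embed \ 𝒟.embed '' O))) := by
  set g := 𝒟.metric with hg
  set τ := 𝒟.timeOrientation with hτ_def
  have hn2 : (2 : ℕ∞ω) ≤ ∞ := WithTop.coe_le_coe.mpr le_top
  have hS : g.IsCauchyHypersurface τ (range 𝒟.embed) := 𝒟.isCauchyHypersurface
  have hinj : Injective 𝒟.embed := 𝒟.isSmoothEmbedding.isEmbedding.injective
  -- `ιX ∖ ι(O) = ι(Oᶜ) =: A`, compact, contained in `ιX`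
  have hAeq : range 𝒟.embed \ 𝒟.embed '' O = 𝒟.embed '' Oᶜ := by
    ext σ
    constructor
    · rintro ⟨⟨y, rfl⟩, hy⟩
      exact ⟨y, fun hyO ↦ hy ⟨y, hyO, rfl⟩, rfl⟩
    · rintro ⟨y, hy, rfl⟩
      exact ⟨⟨y, rfl⟩, fun ⟨z, hz, hzy⟩ ↦ hy (hinj hzy ▸ hz)⟩
  rw [hAeq]
  set A : Set 𝒟.carrier := 𝒟.embed '' Oᶜ with hA_def
  have hAS : A ⊆ range 𝒟.embed := image_subset_range _ _
  have hAc : IsCompact A := hK.image 𝒟.isSmoothEmbedding.contMDiff.continuous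
  have hJA : IsClosed (g.causalFuture τ A) := isClosed_causalFuture_of_isCompact 𝒟 hAc
  -- the slab lemma on `ι(O)`
  have hOpen : ∀ a ∈ 𝒟.embed '' O, ∀ᶠ σ in 𝓝 a, σ ∈ range 𝒟.embed → σ ∈ 𝒟.embed '' O := by
    rintro _ ⟨y, hy, rfl⟩
    exact 𝒟.toDataEmbedding.eventually_mem_image_of_isOpen hO hy
  have hslab : ∀ a ∈ 𝒟.embed '' O, ∃ ν : TangentSpace (𝓡 (n + 1)) a,
      g.IsTimelike ν ∧ τ.IsFutureDirected ν ∧ ∀ κ : ℝ, 0 < κ → ∀ᶠ σ in 𝓝 a, σ ∈ range 𝒟.embed →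
        |g.val a ν (extChartAt (𝓡 (n + 1)) a σ - extChartAt (𝓡 (n + 1)) a a)| ≤
          κ * ‖extChartAt (𝓡 (n + 1)) a σ - extChartAt (𝓡 (n + 1)) a a‖ := by
    rintro _ ⟨y, hy, rfl⟩
    refine ⟨𝒟.normal y, ?_, 𝒟.isFutureUnitNormal.2 y, fun κ hκ ↦
      𝒟.toDataEmbedding.eventually_abs_val_normal_le y hκ⟩
    show g.val _ (𝒟.normal y) (𝒟.normal y) < 0
    rw [𝒟.isFutureUnitNormal.1.2 y]
    norm_num
  have hdisj := LorentzianMetric.IsCauchyHypersurface.disjoint_closure_of_spacelike hn2 hS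
    (image_subset_range _ _) hOpen hslab
  rw [hAeq] at hdisj
  -- the two cases
  refine Set.disjoint_left.2 fun p hp hpcl ↦ ?_
  by_cases hpS : p ∈ range 𝒟.embed
  · -- `p ∈ ιX ∖ A = ι(O)`
    have hpO : p ∈ 𝒟.embed '' O := by
      obtain ⟨y, rfl⟩ := hpS
      refine ⟨y, by_contra fun hyO ↦ hp.2 ?_, rfl⟩
      exact LorentzianMetric.subset_causalFuture g τ A ⟨y, hyO, rfl⟩
    exact Set.disjoint_left.1 hdisj hpO hpcl
  · -- `p ∈ I⁺(ιX)`, open, missing `I⁻(A) ∪ A`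
    have hpI : p ∈ g.chronologicalFuture τ (range 𝒟.embed) :=
      hS.mem_chronologicalFuture_of_mem_causalFuture_diff hn2 hp.1 hpS
    have hIopen : IsOpen (g.chronologicalFuture τ (range 𝒟.embed)) :=
      LorentzianMetric.isOpen_chronologicalFuture_of_boundaryless g τ _
    rw [closure_union, closure_union, mem_union, mem_union] at hpcl
    rcases hpcl with (hp1 | hp2) | hp3
    · -- `closure I⁺(A) ⊆ J⁺(A)`
      have : p ∈ g.causalFuture τ A :=
        (closure_minimal (LorentzianMetric.chronologicalFuture_subset_causalFuture g τ A) hJA) hp1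
      exact hp.2 this
    · -- a point of `I⁻(A) ⊆ I⁻(ιX)` in the open neighbourhood `I⁺(ιX)` of `p`
      obtain ⟨z, hzI, hzA⟩ := mem_closure_iff_nhds.1 hp2 _ (hIopen.mem_nhds hpI)
      have hzS : z ∈ g.chronologicalPast τ (range 𝒟.embed) :=
        LorentzianMetric.chronologicalFuture_mono (τ := τ.reverse) hAS hzA
      exact Set.disjoint_left.1 (hS.disjoint_chronologicalFuture_chronologicalPast hn2) hzI hzS
    · -- a point of `A ⊆ ιX` in `I⁺(ιX)`: against achronality
      obtain ⟨z, hzI, hzA⟩ := mem_closure_iff_nhds.1 hp3 _ (hIopen.mem_nhds hpI)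
      have hach : g.IsAchronal τ (range 𝒟.embed) :=
        LorentzianMetric.IsCauchyHypersurface.isAchronal_holds hn2 hS
      exact Set.disjoint_left.1 ((LorentzianMetric.isAchronal_iff_disjoint _).1 hach) hzI (hAS hzA)

end Summit.FinalStateConjecture.FinalStateConjecture.Theorems.PhotonSphereChannels.TameCensorshipCrush

end
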